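import Mathlib.Analysis.SpecialFunctions.Complex.LogDeriv
import Mathlib.Analysis.SpecialFunctions.Complex.Circle
import Mathlib.Analysis.SpecialFunctions.Log.Deriv
import Mathlib.Analysis.InnerProductSpace.Calculus
import HarnessLib

/-!
# Smooth local branches: the square root near a non-zero complex number, a SIMPLE root of a monic quadratic as a function of its coefficients, the argument near a non-zero
# complex number, and the log-modulus (Ahlfors, *Complex Analysis*, Ch. 3 §2; folklore)

Topic `Analysis/Calculus`; namespace `Literature.Analysis.Calculus`.  THEOREMS ONLY (no `def`, no instance, no notation, no axiom, no named fact, no `sorry`); Mathlib-only.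
Cell `pub/hodgecm-mathlib`, crux H413 (`stmt-HodgeConjecture-24833`), line LH3, letter L3′ SURJ-OF-FORWARD road, organ (Σ-REG): the ANALYTIC INPUTS of the smooth local section of the class map
`bzClassMap S` at a regular chart point ((Σ4c-sec), LH3-p03 (g6)); kit (Σ4c-kit) of F0P3a-p04 (g25) (binder of (Σ-REG)), 2026-09-02.  Count-neutral.

EVERYTHING is an explicit formula through `Complex.log` on the slit plane (Mathlib `Complex.contDiffAt_log`), no inverse-function theorem:
* §1 **`Complex.exists_contDiffOn_sqrt_near`** — near `w₀ ≠ 0`, for a chosen `μ` with `μ² = w₀`, the branch `s z = μ · exp(log(z∕μ²)∕2)` is `C^∞` (real sense) on the open set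
  `{z | z∕μ² ∈ slitPlane} ∋ w₀`, `s w₀ = μ`, `s z² = z`.
* §2 **`exists_contDiffOn_quadraticRoot_near`** — near coefficients `(t₀, d₀)` with `t₀² ≠ 4d₀`, a SIMPLE root `λ₁` of `λ² − t₀λ + d₀` extends to a smooth root `r(t, d) = (t + s(t² − 4d))∕2`
  (`μ := 2λ₁ − t₀`); the other root is `t − r`, and `r(t − r) = d` (Vieta).
* §3 **`Complex.exists_contDiffOn_arg_near`** — near `z₀ ≠ 0` with `‖z₀‖·e^{iθ₀} = z₀`, the branch `θ z = θ₀ + Im log(z·e^{−iθ₀})` is smooth on `{z | z·e^{−iθ₀} ∈ slitPlane}`, `θ z₀ = θ₀`,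
  `‖z‖ · e^{iθ(z)} = z` (Mathlib `Complex.norm_mul_exp_arg_mul_I`).
* §4 `contDiffAt_log_norm` — `z ↦ log ‖z‖` is smooth off `0`, `exp (log ‖z‖) = ‖z‖`.
HONEST LABEL: calculus plumbing; HC_CM is proved only modulo the 7 printed citations (2 remaining: hLiu418 = stmt-HodgeConjecture-24832, h413 = stmt-HodgeConjecture-24833) until rung 0 closes.

## References
* [Ahlfors1979] L. V. Ahlfors, *Complex Analysis*, 3rd ed. (1979), Ch. 3 §2 (branches of `log` and `√`), Ch. 8 §2 (simple roots depend analytically on coefficients).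
-/

set_option autoImplicit false

noncomputable section

open Complex Set Topology
open scoped ContDiff Real

namespace Literature.Analysis.Calculus

/-! ## §1 A smooth square root near a non-zero complex number -/

/-- **SMOOTH SQUARE ROOT NEAR `w₀ ≠ 0` THROUGH A CHOSEN ROOT `μ`** (`μ² = w₀`): `s z = μ·exp(log(z∕μ²)∕2)` on the open set `{z | z∕μ² ∈ slitPlane}` (which contains `w₀`, where `z∕μ² = 1`).
[cite: Ahlfors1979, Ch. 3 §2] -/
theorem Complex.exists_contDiffOn_sqrt_near {w₀ μ : ℂ} (hμ : μ ^ 2 = w₀) (hw₀ : w₀ ≠ 0) :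
    ∃ U : Set ℂ, IsOpen U ∧ w₀ ∈ U ∧ ∃ s : ℂ → ℂ, ContDiffOn ℝ ∞ s U ∧ s w₀ = μ ∧ ∀ z ∈ U, s z ^ 2 = z := by
  have hμ0 : μ ≠ 0 := fun h => hw₀ (by rw [← hμ, h]; ring)
  have hμ2 : μ ^ 2 ≠ 0 := pow_ne_zero _ hμ0
  refine ⟨{z | z / μ ^ 2 ∈ slitPlane}, Complex.isOpen_slitPlane.preimage (continuous_id.div_const _), ?_, fun z => μ * exp (log (z / μ ^ 2) / 2), ?_, ?_, fun z hz => ?_⟩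
  · show w₀ / μ ^ 2 ∈ slitPlane
    rw [← hμ, div_self hμ2]
    exact Complex.one_mem_slitPlane
  · intro z hz
    have h1 : ContDiffAt ℂ ∞ (fun z : ℂ => μ * exp (log (z / μ ^ 2) / 2)) z :=
      contDiffAt_const.mul (((Complex.contDiffAt_log hz).comp z (contDiffAt_id.div_const _)).div_const _).cexp
    exact (h1.restrict_scalars ℝ).contDiffWithinAt
  · show μ * exp (log (w₀ / μ ^ 2) / 2) = μ
    rw [← hμ, div_self hμ2, Complex.log_one, zero_div, Complex.exp_zero, mul_one]
  · have hz0 : z / μ ^ 2 ≠ 0 := Complex.slitPlane_ne_zero hz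
    calc (μ * exp (log (z / μ ^ 2) / 2)) ^ 2 = μ ^ 2 * (exp (log (z / μ ^ 2) / 2) * exp (log (z / μ ^ 2) / 2)) := by ring
      _ = μ ^ 2 * exp (log (z / μ ^ 2)) := by rw [← Complex.exp_add, add_halves]
      _ = z := by rw [Complex.exp_log hz0, mul_div_cancel₀ _ hμ2]

/-! ## §2 A simple root of a monic quadratic is a smooth function of the coefficients -/

/-- **SMOOTH SIMPLE ROOT OF `λ² − tλ + d`** near coefficients `(t₀, d₀)` with non-zero discriminant, through the chosen root `λ₁` (`lam`): `r(t, d) = (t + s(t² − 4d))∕2` with `s` the square-root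
branch of §1 at `μ = 2λ₁ − t₀` (`μ² = t₀² − 4d₀`).  Vieta: the other root is `t − r` and `r·(t − r) = d`. [cite: Ahlfors1979, Ch. 8 §2] -/
theorem exists_contDiffOn_quadraticRoot_near {t₀ d₀ lam : ℂ} (hlam : lam ^ 2 - t₀ * lam + d₀ = 0) (hdisc : t₀ ^ 2 - 4 * d₀ ≠ 0) :
    ∃ U : Set (ℂ × ℂ), IsOpen U ∧ (t₀, d₀) ∈ U ∧ ∃ r : ℂ × ℂ → ℂ, ContDiffOn ℝ ∞ r U ∧ r (t₀, d₀) = lam ∧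
      ∀ p ∈ U, r p ^ 2 - p.1 * r p + p.2 = 0 ∧ r p * (p.1 - r p) = p.2 := by
  have hμ : (2 * lam - t₀) ^ 2 = t₀ ^ 2 - 4 * d₀ := by linear_combination (4 : ℂ) * hlam
  obtain ⟨V, hV, hV₀, s, hs, hs₀, hsq⟩ := Complex.exists_contDiffOn_sqrt_near hμ hdisc
  have hdc : Continuous fun p : ℂ × ℂ => p.1 ^ 2 - 4 * p.2 := by fun_prop
  refine ⟨(fun p : ℂ × ℂ => p.1 ^ 2 - 4 * p.2) ⁻¹' V, hV.preimage hdc, hV₀, fun p => (p.1 + s (p.1 ^ 2 - 4 * p.2)) / 2, ?_, ?_, fun p hp => ?_⟩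
  · have hd : ContDiff ℝ ∞ fun p : ℂ × ℂ => p.1 ^ 2 - 4 * p.2 := by fun_prop
    exact ((contDiff_fst.contDiffOn).add (hs.comp hd.contDiffOn fun p hp => hp)).div_const _
  · show (t₀ + s (t₀ ^ 2 - 4 * d₀)) / 2 = lam
    rw [hs₀]; ring
  · have h2 := hsq _ hp
    constructor
    · linear_combination (1 / 4 : ℂ) * h2
    · linear_combination (-(1 / 4 : ℂ)) * h2

/-! ## §3 A smooth argument near a non-zero complex number -/

/-- **SMOOTH ARGUMENT BRANCH NEAR `z₀ ≠ 0` THROUGH A CHOSEN ANGLE `θ₀`** (`‖z₀‖·e^{iθ₀} = z₀`): `θ z = θ₀ + Im log (z · e^{−iθ₀})` on the open set `{z | z·e^{−iθ₀} ∈ slitPlane}`, with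
`‖z‖ · e^{iθ(z)} = z` there. [cite: Ahlfors1979, Ch. 3 §2] -/
theorem Complex.exists_contDiffOn_arg_near {z₀ : ℂ} {θ₀ : ℝ} (hz₀ : z₀ ≠ 0) (hθ₀ : (‖z₀‖ : ℂ) * Circle.exp θ₀ = z₀) :
    ∃ U : Set ℂ, IsOpen U ∧ z₀ ∈ U ∧ ∃ θ : ℂ → ℝ, ContDiffOn ℝ ∞ θ U ∧ θ z₀ = θ₀ ∧ ∀ z ∈ U, (‖z‖ : ℂ) * Circle.exp (θ z) = z := by
  have he : (Circle.exp θ₀ : ℂ) * exp (-(θ₀ * I)) = 1 := by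
    rw [Circle.coe_exp, ← Complex.exp_add, add_neg_cancel, Complex.exp_zero]
  refine ⟨{z | z * exp (-(θ₀ * I)) ∈ slitPlane}, Complex.isOpen_slitPlane.preimage (continuous_id.mul continuous_const), ?_,
    fun z => θ₀ + (log (z * exp (-(θ₀ * I)))).im, ?_, ?_, fun z hz => ?_⟩
  · show z₀ * exp (-(θ₀ * I)) ∈ slitPlane
    rw [← hθ₀, mul_assoc, he, mul_one]
    exact Complex.ofReal_mem_slitPlane.2 (norm_pos_iff.2 hz₀)
  · intro z hz
    have h1 : ContDiffAt ℂ ∞ (fun z : ℂ => log (z * exp (-(θ₀ * I)))) z := (Complex.contDiffAt_log hz).comp z (contDiffAt_id.mul contDiffAt_const)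
    exact (contDiffAt_const.add (Complex.imCLM.contDiff.contDiffAt.comp z (h1.restrict_scalars ℝ))).contDiffWithinAt
  · show θ₀ + (log (z₀ * exp (-(θ₀ * I)))).im = θ₀
    rw [← hθ₀, mul_assoc, he, mul_one, Complex.log_im, Complex.arg_ofReal_of_nonneg (norm_nonneg _), add_zero]
  · have hv0 : z * exp (-(θ₀ * I)) ≠ 0 := Complex.slitPlane_ne_zero hz
    have hnorm : ‖z * exp (-(θ₀ * I))‖ = ‖z‖ := by
      rw [norm_mul, show -((θ₀ : ℂ) * I) = ((-θ₀ : ℝ) : ℂ) * I by push_cast; ring, Complex.norm_exp_ofReal_mul_I, mul_one]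
    have key := Complex.norm_mul_exp_arg_mul_I (z * exp (-(θ₀ * I)))
    rw [hnorm, ← Complex.log_im] at key
    rw [Circle.coe_exp, Complex.ofReal_add, add_mul, Complex.exp_add, ← Circle.coe_exp]
    calc (‖z‖ : ℂ) * ((Circle.exp θ₀ : ℂ) * exp (((log (z * exp (-(θ₀ * I)))).im : ℂ) * I))
        = ((‖z‖ : ℂ) * exp (((log (z * exp (-(θ₀ * I)))).im : ℂ) * I)) * (Circle.exp θ₀ : ℂ) := by ring
      _ = z * exp (-(θ₀ * I)) * (Circle.exp θ₀ : ℂ) := by rw [key]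
      _ = z := by rw [mul_assoc, mul_comm (exp _), he, mul_one]

/-! ## §4 The log-modulus -/

/-- `z ↦ log ‖z‖` is smooth off `0` and `exp (log ‖z‖) = ‖z‖` there. [cite: Ahlfors1979, Ch. 3 §2] -/
theorem contDiffAt_log_norm {z : ℂ} (hz : z ≠ 0) : ContDiffAt ℝ ∞ (fun z : ℂ => Real.log ‖z‖) z ∧ Real.exp (Real.log ‖z‖) = ‖z‖ :=
  ⟨(contDiffAt_norm ℝ hz).log (norm_ne_zero_iff.2 hz), Real.exp_log (norm_pos_iff.2 hz)⟩

end Literature.Analysis.Calculus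

end
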